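import Summits.CriticalPhenomena.Ising3DConformalLimit.Theses.MirrorHoelderCompactness
import Summits.CriticalPhenomena.Ising3DConformalLimit.Theses.HyperoctahedralRP
import Summits.CriticalPhenomena.Ising3DConformalLimit.Theses.AnomalousForcesInteraction
import Summits.CriticalPhenomena.Ising3DConformalLimit.Theorems.HyperoctahedralRPHRP2Rigidity
import Summits.CriticalPhenomena.Ising3DConformalLimit.Theorems.HyperoctahedralRPLimitRotationInvariant
import Summits.CriticalPhenomena.Ising3DConformalLimit.Theorems.AnomalousForcesInteractionDeltaLowerBound
import HarnessLib

/-!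
# Crux `MirrorHoelderCompactness.LimitsAreConformal` (stmt-CriticalPhenomena-6154) — birth skeleton (BC3)

Skeleton-register seat `planner-skel-stmt-CriticalPhenomena-6154-0`, 2026-08-17 (route re-audit bin REPAIRABLE),
published as `Cruxes/LimitsAreConformal/Lines/birth.lean`.

The crux (rank 6 of route `MirrorHoelderCompactness`, "imported complement"; also wanted by route
`MonotoneBlocking`): every pointwise scaling limit `S` of `criticalCorr 3` (renormalisation `ρ > 0` on `(0,1]`)
that is normalised (`S = 0` off `NonCoincident`), non-degenerate, translation invariant and scale covariant
with weight `Δ` is (i) `O(3)`-invariant, (ii) inversion covariant with the same `Δ`, (iii) non-Gaussian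
(`HasNontrivialU4 S`).

## What the tree already has (2026-08-17) — conjunct (i) is PROVED

* `Cruxes.HRP2Rigidity.XRayMellin.HRP2Rigidity_of : HyperoctahedralRP.HRP2Rigidity` (item 1979, closed/proved,
  `Theorems/HyperoctahedralRPHRP2Rigidity.lean`) and
  `Cruxes.LimitRotationInvariant.QuarterTurnLiouville.limitRotationInvariant_proof :
  HyperoctahedralRP.LimitRotationInvariant` (item 1980, closed/proved,
  `Theorems/HyperoctahedralRPLimitRotationInvariant.lean`): together they give `IsRotationInvariant S` under
  EXACTLY the hypotheses of this crux (`isRotationInvariant_of_hypotheses` below, sorry-free). So the route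
  file's "all three conclusions open" is out of date: only (ii) and (iii) remain.
* `Theorems.DeltaLowerBound_proof : AnomalousForcesInteraction.DeltaLowerBound` (item 2602, closed/proved): a
  lattice bound `⟨σ₀σ_x⟩_{β_c} ≤ C‖x‖^{-a}` forces `a ≤ 2Δ` for every non-degenerate scale-covariant limit.

## The line (three registered stubs = three OPEN ledger items, verbatim; the only `sorry`s of this file)

* `stub_inversionUpgradeNormalised` — conjunct (ii): VERBATIM item stmt-CriticalPhenomena-1982
  (`HyperoctahedralRP.InversionUpgradeNormalised`, shared by 12 routes; `Iff.rfl` below): a normalised,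
  non-degenerate, EUCLIDEAN-invariant, scale-covariant limit of `criticalCorr 3` is inversion covariant. Its own
  chain has reduced it with ZERO SLACK to two weight-free lattice ratio inequalities
  (`InversionUpgradeNormalised_iff_latticeOneSided`, `Theorems/HyperoctahedralRPInversionUpgradeNormalisedConditional.lean`)
  and to route `CurrentConnectionInvariance`'s crux 4840 (`InversionUpgradeNormalised_of_ratioInversionInvariance`).
  Euclidean invariance is available here because (i) is proved. [open; XL]
* `stub_etaPositive` — VERBATIM item stmt-CriticalPhenomena-2600 (`AnomalousForcesInteraction.EtaPositive`,
  also `OctaveForgetting`): `η(3) > 0` in upper-bound power form, `⟨σ₀σ_x⟩_{β_c(3)} ≤ C‖x‖^{-(1+κ)}`, `κ > 0`.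
  With the landed `DeltaLowerBound_proof` it gives `1/2 < Δ` for every limit in the scope of the crux
  (`half_lt_weight_of_etaPositive` below, sorry-free). [open; the famous lattice problem, η ≈ 0.036]
* `stub_gaussianLimitIsFree` — VERBATIM item stmt-CriticalPhenomena-2601
  (`AnomalousForcesInteraction.GaussianLimitIsFree`, also `OctaveForgetting`; its own crux dir has a birth line):
  a non-degenerate, translation-invariant, scale-covariant limit of `criticalCorr 3` with `U₄ ≡ 0` has `Δ = 1/2`
  (Newman's Lee–Yang Gaussianity + Markov inheritance + Pitt–Kotani–Rozanov). [open; XL]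

Conjunct (iii) is then the ANOMALOUS-DIMENSION DICHOTOMY: `¬ HasNontrivialU4 S ⇒ Δ = 1/2` (stub 3) contradicts
`1/2 < Δ` (stub 2 + `DeltaLowerBound_proof`). This is the non-Gaussianity mechanism of route
`AnomalousForcesInteraction`, chosen here over the monolithic item stmt-CriticalPhenomena-0636
(`IsingEuclidUpgradeR4NonGaussian`, named in the crux docstring) because the 0636 crux chain is `line-dead` ×3
with the standing recommendation "do not re-line 0636 with another current costume"
(`Cruxes/IsingEuclidUpgradeR4NonGaussian/PICKED.md`, NOTES.md, 2026-08-16); 0636, if it lands, ALSO closes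
this crux (replace the `by_contra` block of `LimitsAreConformal_of` by `h0636 ρ S hρ hlim hnd`). The crux docstring
itself allows "any other isotropy/inversion/non-Gaussianity line".

## Composition

`LimitsAreConformal_of : Sig.stub_inversionUpgradeNormalised → Sig.stub_etaPositive → Sig.stub_gaussianLimitIsFree →
LimitsAreConformal` (sorry-free; axioms of the composition itself = those of the landed theorems it calls), and
`LimitsAreConformal_of_stubs : LimitsAreConformal` from the three registered stubs (this also kernel-checks that each
`Sig.stub_X` is syntactically the registered signature of `stub_X`). The `Sig.stub_*` named propositions exist so
that the skeleton audit admits the hypotheses of `LimitsAreConformal_of` BY NAME; `sig_*_iff_item*` record by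
`Iff.rfl` that they ARE the ledger items 1982 / 2600 / 2601.

Disproof used: none exists for this crux (`ledger crux ls stmt-CriticalPhenomena-6154`: no workfiles at
registration). Honoured from the imported items: 1982's `Theorems/InversionUpgradeNormalised/Negative/
LoadBearingHypotheses.lean` (`not_cruxWithoutNormalisation`, `not_cruxWithoutScaleCovariance`,
`not_cruxWithoutIsingLimit`: stub 1 keeps all three hypotheses — it is the item verbatim) and
`Literature.Barriers.CriticalPhenomena.ScaleCovarianceNotMoebius` (model-blind Euclid+scale ⇏ inversion: stub 1 keeps
the `HasPointwiseScalingLimit (criticalCorr 3)` hypothesis); `LongRangeTrivialityOnZ3` /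
`IsingTrivialityFromDimensionFour` bite conjunct (iii) only through stub 3 (a Gaussian limit is allowed there — it
is then forced to be free) and stub 2 (false in `d ≥ 5` form; `d = 3`-specific). Negatives index
(`ledger negatives --problem CriticalPhenomena`, 11 entries, 2026-08-17): none concerns Ising3DConformalLimit
statements of this shape.
-/

noncomputable section

namespace Summit.CriticalPhenomena.Ising3DConformalLimit.Cruxes.LimitsAreConformal.Birth

open Literature.Probability.LatticeModels
open Summit.CriticalPhenomena.Ising3DConformalLimit.Theses

/-! ## §1 The stub statements as named propositions (verbatim ledger signatures of items 1982 / 2600 / 2601) -/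

/-- Statement of `stub_inversionUpgradeNormalised` = item stmt-CriticalPhenomena-1982 verbatim. -/
def Sig.stub_inversionUpgradeNormalised : Prop :=
  ∀ (ρ : ℝ → ℝ) (Δ : ℝ) (S : Literature.Probability.LatticeModels.CorrFamily 3), (∀ δ ∈ Set.Ioc (0:ℝ) 1, 0 < ρ δ)
  → Literature.Probability.LatticeModels.HasPointwiseScalingLimit (Literature.Probability.LatticeModels.criticalCorr 3) ρ S
  → (∀ n z, z ∉ Literature.Probability.LatticeModels.NonCoincident 3 n → S n z = 0)
  → Literature.Probability.LatticeModels.IsNondegenerateTwoPoint S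
  → Literature.Probability.LatticeModels.IsEuclideanInvariant S
  → Literature.Probability.LatticeModels.IsScaleCovariant Δ S
  → Literature.Probability.LatticeModels.IsInversionCovariant Δ S

/-- Statement of `stub_etaPositive` = item stmt-CriticalPhenomena-2600 verbatim. -/
def Sig.stub_etaPositive : Prop :=
  ∃ κ C : ℝ, 0 < κ ∧ ∀ x : Literature.Probability.LatticeModels.Site 3, x ≠ 0
  → Literature.Probability.LatticeModels.criticalTwoPoint 3 x ≤ C * (‖x‖ : ℝ) ^ (-(1 + κ))

/-- Statement of `stub_gaussianLimitIsFree` = item stmt-CriticalPhenomena-2601 verbatim. -/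
def Sig.stub_gaussianLimitIsFree : Prop :=
  ∀ (ρ : ℝ → ℝ) (Δ : ℝ) (S : Literature.Probability.LatticeModels.CorrFamily 3), (∀ δ ∈ Set.Ioc (0:ℝ) 1, 0 < ρ δ)
  → Literature.Probability.LatticeModels.HasPointwiseScalingLimit (Literature.Probability.LatticeModels.criticalCorr 3) ρ S
  → Literature.Probability.LatticeModels.IsNondegenerateTwoPoint S
  → Literature.Probability.LatticeModels.IsTranslationInvariant S
  → Literature.Probability.LatticeModels.IsScaleCovariant Δ S
  → ¬ Literature.Probability.LatticeModels.HasNontrivialU4 S → Δ = 1 / 2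

/-! ## §2 Registered stubs (the ONLY `sorry`s of this file) -/

/-- **Stub 1 (conjunct (ii), inversion upgrade; = item stmt-CriticalPhenomena-1982).** Every normalised,
non-degenerate, Euclidean-invariant, scale-covariant (weight `Δ`) pointwise scaling limit of `criticalCorr 3`
(`ρ > 0` on `(0,1]`) is inversion covariant with the same `Δ`. Open; model-blind version false
(`ScaleCovarianceNotMoebius`); zero-slack lattice form: `InversionUpgradeNormalised_iff_latticeOneSided`. -/
theorem stub_inversionUpgradeNormalised :
    ∀ (ρ : ℝ → ℝ) (Δ : ℝ) (S : Literature.Probability.LatticeModels.CorrFamily 3), (∀ δ ∈ Set.Ioc (0:ℝ) 1, 0 < ρ δ)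
    → Literature.Probability.LatticeModels.HasPointwiseScalingLimit (Literature.Probability.LatticeModels.criticalCorr 3) ρ S
    → (∀ n z, z ∉ Literature.Probability.LatticeModels.NonCoincident 3 n → S n z = 0)
    → Literature.Probability.LatticeModels.IsNondegenerateTwoPoint S
    → Literature.Probability.LatticeModels.IsEuclideanInvariant S
    → Literature.Probability.LatticeModels.IsScaleCovariant Δ S
    → Literature.Probability.LatticeModels.IsInversionCovariant Δ S := by
  sorry

/-- **Stub 2 (`η(3) > 0`, power form; = item stmt-CriticalPhenomena-2600).** There are `κ > 0` and `C` with
`⟨σ₀σ_x⟩⁺_{β_c(3)} ≤ C‖x‖^{-(1+κ)}` for all `x ≠ 0` in `ℤ³`. Open (numerically η ≈ 0.036; rigorously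
`0 ≤ η ≤ 1/2`, `criticalTwoPoint_bounds_holds`, Duminil-Copin–Panis 2025 Thm 1.5). -/
theorem stub_etaPositive :
    ∃ κ C : ℝ, 0 < κ ∧ ∀ x : Literature.Probability.LatticeModels.Site 3, x ≠ 0
    → Literature.Probability.LatticeModels.criticalTwoPoint 3 x ≤ C * (‖x‖ : ℝ) ^ (-(1 + κ)) := by
  sorry

/-- **Stub 3 (a Gaussian limit is free; = item stmt-CriticalPhenomena-2601).** Every non-degenerate,
translation-invariant, scale-covariant (weight `Δ`) pointwise scaling limit of `criticalCorr 3` (`ρ > 0` on `(0,1]`)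
whose connected four-point function vanishes identically on non-coincident configurations has `Δ = 1/2`. Open (XL). -/
theorem stub_gaussianLimitIsFree :
    ∀ (ρ : ℝ → ℝ) (Δ : ℝ) (S : Literature.Probability.LatticeModels.CorrFamily 3), (∀ δ ∈ Set.Ioc (0:ℝ) 1, 0 < ρ δ)
    → Literature.Probability.LatticeModels.HasPointwiseScalingLimit (Literature.Probability.LatticeModels.criticalCorr 3) ρ S
    → Literature.Probability.LatticeModels.IsNondegenerateTwoPoint S
    → Literature.Probability.LatticeModels.IsTranslationInvariant S
    → Literature.Probability.LatticeModels.IsScaleCovariant Δ S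
    → ¬ Literature.Probability.LatticeModels.HasNontrivialU4 S → Δ = 1 / 2 := by
  sorry

/-! ## §3 The stubs ARE the ledger items (kernel-checked identities) -/

/-- `Sig.stub_inversionUpgradeNormalised` is item 1982 (`HyperoctahedralRP.InversionUpgradeNormalised`), syntactically. -/
theorem sig_inversionUpgradeNormalised_iff_item1982 :
    Sig.stub_inversionUpgradeNormalised ↔ HyperoctahedralRP.InversionUpgradeNormalised :=
  Iff.rfl

/-- `Sig.stub_etaPositive` is item 2600 (`AnomalousForcesInteraction.EtaPositive`), syntactically. -/
theorem sig_etaPositive_iff_item2600 :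
    Sig.stub_etaPositive ↔ AnomalousForcesInteraction.EtaPositive :=
  Iff.rfl

/-- `Sig.stub_gaussianLimitIsFree` is item 2601 (`AnomalousForcesInteraction.GaussianLimitIsFree`), syntactically. -/
theorem sig_gaussianLimitIsFree_iff_item2601 :
    Sig.stub_gaussianLimitIsFree ↔ AnomalousForcesInteraction.GaussianLimitIsFree :=
  Iff.rfl

/-! ## §4 Landed inputs, isolated (sorry-free) -/

/-- **Conjunct (i) is a theorem of the tree.** Under exactly the hypotheses of the crux, `S` is `O(3)`-invariant:
items 1979 (`HRP2Rigidity_of`) and 1980 (`limitRotationInvariant_proof`) of route `HyperoctahedralRP`, both landed. -/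
theorem isRotationInvariant_of_hypotheses {ρ : ℝ → ℝ} {Δ : ℝ} {S : CorrFamily 3}
    (hρ : ∀ δ ∈ Set.Ioc (0:ℝ) 1, 0 < ρ δ) (hlim : HasPointwiseScalingLimit (criticalCorr 3) ρ S)
    (hnorm : ∀ n z, z ∉ NonCoincident 3 n → S n z = 0) (hnd : IsNondegenerateTwoPoint S)
    (htr : IsTranslationInvariant S) (hsc : IsScaleCovariant Δ S) : IsRotationInvariant S :=
  Summit.CriticalPhenomena.Ising3DConformalLimit.Cruxes.LimitRotationInvariant.QuarterTurnLiouville.limitRotationInvariant_proof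
    Summit.CriticalPhenomena.Ising3DConformalLimit.Cruxes.HRP2Rigidity.XRayMellin.HRP2Rigidity_of
    ρ Δ S hρ hlim hnorm hnd htr hsc

/-- **Stub 2 + landed `DeltaLowerBound_proof` (item 2602) ⇒ the weight of every limit in scope exceeds `1/2`.** -/
theorem half_lt_weight_of_etaPositive (hAP : Sig.stub_etaPositive) {ρ : ℝ → ℝ} {Δ : ℝ} {S : CorrFamily 3}
    (hρ : ∀ δ ∈ Set.Ioc (0:ℝ) 1, 0 < ρ δ) (hlim : HasPointwiseScalingLimit (criticalCorr 3) ρ S)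
    (hnd : IsNondegenerateTwoPoint S) (hsc : IsScaleCovariant Δ S) : 1 / 2 < Δ := by
  obtain ⟨κ, C, hκ, hG⟩ := hAP
  have h : 1 + κ ≤ 2 * Δ :=
    Summit.CriticalPhenomena.Ising3DConformalLimit.Theorems.DeltaLowerBound_proof (1 + κ) C ρ Δ S hG hρ hlim hnd hsc
  linarith

/-- **Conjunct (iii) from stubs 2 and 3 (the anomalous-dimension dichotomy).** -/
theorem hasNontrivialU4_of_stubs (hAP : Sig.stub_etaPositive) (hGF : Sig.stub_gaussianLimitIsFree)
    {ρ : ℝ → ℝ} {Δ : ℝ} {S : CorrFamily 3}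
    (hρ : ∀ δ ∈ Set.Ioc (0:ℝ) 1, 0 < ρ δ) (hlim : HasPointwiseScalingLimit (criticalCorr 3) ρ S)
    (hnd : IsNondegenerateTwoPoint S) (htr : IsTranslationInvariant S) (hsc : IsScaleCovariant Δ S) :
    HasNontrivialU4 S := by
  by_contra hU4
  have hhalf : 1 / 2 < Δ := half_lt_weight_of_etaPositive hAP hρ hlim hnd hsc
  have hΔ : Δ = 1 / 2 := hGF ρ Δ S hρ hlim hnd htr hsc hU4
  linarith

/-! ## §5 Composition — the crux BY NAME from the three stubs (sorry-free) -/

/-- **COMPOSITION.** `Sig.stub_inversionUpgradeNormalised → Sig.stub_etaPositive → Sig.stub_gaussianLimitIsFree →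
LimitsAreConformal`: fix `ρ, Δ, S` and the six hypotheses of the crux; (i) rotation invariance is the landed
`isRotationInvariant_of_hypotheses`, whence Euclidean invariance `⟨transl, rot⟩`; (ii) inversion covariance is
stub 1 fed with it; (iii) `HasNontrivialU4` is `hasNontrivialU4_of_stubs` (stub 3 would force `Δ = 1/2`, stub 2 with
the landed `DeltaLowerBound_proof` gives `1/2 < Δ`). Concludes
`Summit.CriticalPhenomena.Ising3DConformalLimit.Theses.MirrorHoelderCompactness.LimitsAreConformal` by name. -/
theorem LimitsAreConformal_of :
    Sig.stub_inversionUpgradeNormalised → Sig.stub_etaPositive → Sig.stub_gaussianLimitIsFree →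
      Summit.CriticalPhenomena.Ising3DConformalLimit.Theses.MirrorHoelderCompactness.LimitsAreConformal := by
  intro hInv hAP hGF ρ Δ S hρ hlim hnorm hnd htr hsc
  have hrot : IsRotationInvariant S := isRotationInvariant_of_hypotheses hρ hlim hnorm hnd htr hsc
  have heuc : IsEuclideanInvariant S := ⟨htr, hrot⟩
  exact ⟨hrot, hInv ρ Δ S hρ hlim hnorm hnd heuc hsc, hasNontrivialU4_of_stubs hAP hGF hρ hlim hnd htr hsc⟩

/-- The crux from the registered stubs (closed modulo exactly `stub_inversionUpgradeNormalised`, `stub_etaPositive`,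
`stub_gaussianLimitIsFree`; kernel-checks `Sig.stub_X ≡` the registered signature of `stub_X`). -/
theorem LimitsAreConformal_of_stubs : Summit.CriticalPhenomena.Ising3DConformalLimit.Theses.MirrorHoelderCompactness.LimitsAreConformal :=
  LimitsAreConformal_of stub_inversionUpgradeNormalised stub_etaPositive stub_gaussianLimitIsFree

end Summit.CriticalPhenomena.Ising3DConformalLimit.Cruxes.LimitsAreConformal.Birth

end
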